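import Summits.SmoothPoincare4.SmoothPoincare4.Theorems.SblfDescentRungOneHelperFoldNFTubeIFT
import Summits.SmoothPoincare4.SmoothPoincare4.Theorems.SblfDescentRungOneHelperFoldNFDescend
import Summits.SmoothPoincare4.SmoothPoincare4.Theorems.SblfDescentRungOneHelperFoldNFFamily
import Literature.Topology.FourManifolds.SimplifiedBrokenLefschetzSidesGenus
import Literature.Topology.FourManifolds.SimplifiedBrokenLefschetzRoundSlices
import Literature.Topology.FourManifolds.GenericFoldChart
import Literature.Topology.FourManifolds.FibrewiseMorseFrame
import Mathlib.Analysis.SpecialFunctions.Trigonometric.ArctanDeriv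
import HarnessLib

/-!
# The `S¹`-parametric fold normal form of the round circle, given a periodic adapted frame

Helper `helper_foldNF_ofFrame` of stub `helper_sliceGluing_foldNormalForm`, line `Sketch`,
crux `SblfDescent.RungOne`.

(Crux item stmt-SmoothPoincare4-18531; skeleton `Cruxes/RungOne/Lines/Sketch.lean`.)

Let `f : X → S²` be a genus-one Lefschetz-free simplified broken Lefschetz fibration on a closed
`4`-manifold with equatorial round image, `v = (0, 0, v₂)` the pole of the torus side.  ASSUME
(the hypothesis `helper_foldNF_frame`, the untwistedness of the round handle): a round circle
`e` parametrised by longitude, a tube `ν₀ : S¹ × ℝ³ ↪ X` about it, and a `C^∞` `1`-periodic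
frame `M t` of `ℝ³` ADAPTED to the page Hessians of the height
`g (t, x) = ⟪v, f (ν₀ (circlePt t, x))⟫`: `∂ₓ∂ₓ g (t, 0) (a, b) = 2 B (M t a, M t b)`,
`B (a, b) = a₀b₀ + a₁b₁ - a₂b₂`.  THEN `f` has the `S¹`-parametric fold normal form about its
round circle: a tube `ν : S¹ × B(0, ε) ↪ X` with zero section the round locus and
`f (ν (u, x)) = (√(1 - s²) u, v₂ s)`, `s = x₀² + x₁² - x₂²`.

Proof.  (1) `helper_foldNF_family`: `g` is `C^∞`, `1`-periodic, with critical zero section.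
(2) The periodic fibrewise Morse lemma with the given frame
(`Splitting.exists_periodic_fibrewiseMorseCoords_of_frame`, Hirsch 1976 Ch. 6 §1 with a
parameter; Banyaga–Hurtubise 2004 Thm. 2): `g (t, x) = -y₀² + y₁² + y₂²`, `y = y (t, x)`
periodic `C^∞` Morse coordinates on a uniform tube (`sigNeg B = 1`).  (3) The longitude of
`f (ν₀ (circlePt t, x))` is `circlePt (t + θ (t, x))` with a `C^∞` periodic offset `θ`
vanishing on the zero section (`arctan` of the rotated coordinates).  (4) The map
`Ψ (t, x) = (t + θ, (y₁, y₂, y₀))` is `C^∞`, equivariant, fixes the zero section and has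
invertible differential there; the periodic tube inverse function theorem
(`helper_foldNF_tubeIFT`) inverts it on a uniform tube and `helper_foldNF_descend` descends
`ν₀ ∘ Ψ⁻¹` to the tube `ν` on `S¹ × B(0, ε)`.  (5) By construction the longitude of `f ∘ ν`
is `u` and its height is `x₀² + x₁² - x₂²`; a point of `S²` is determined by these.

## References

* M. W. Hirsch, *Differential Topology*, GTM 33 (1976), Ch. 6 §1; Ch. 4 §5. [HirschDT1976]
* A. Banyaga, D. E. Hurtubise, *A proof of the Morse–Bott Lemma*, Expo. Math. 22 (2004),
  Thm. 2. [BanyagaHurtubise2004]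
* K. Hayano, *On genus-1 simplified broken Lefschetz fibrations*, Algebr. Geom. Topol. 11
  (2011), Def. 2.1 (4). [Hayano2011]
* R. İ. Baykur, S. Kamada, *Classification of broken Lefschetz fibrations with small fiber
  genera*, J. Math. Soc. Japan 67 (2015), §2, §5. [BaykurKamada2015]
-/

set_option linter.dupNamespace false

noncomputable section

open scoped Manifold ContDiff Topology RealInnerProductSpace
open Set Function Filter Metric Literature.Topology.FourManifolds
  Literature.AlgebraicTopology.SingularHomology

namespace Summit.SmoothPoincare4.SmoothPoincare4.Cruxes.RungOne.Sketch

/-- Local notation: `𝔼 n` is the model Euclidean space `EuclideanSpace ℝ (Fin n)`. -/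
local notation "𝔼 " n:arg => EuclideanSpace ℝ (Fin n)

/-- Local notation: `𝕊²`, the unit sphere of `ℝ³`. -/
local notation "𝕊²" => (Metric.sphere (0 : EuclideanSpace ℝ (Fin 3)) (1 : ℝ))

attribute [local instance] Literature.Topology.FourManifolds.fact_finrank_euclideanSpace_succ

/-! ### Calculus on `ℝ × F` at the zero section -/

/-- **A map constant along the zero section has no horizontal derivative there**: if
`h (s, 0) = c` for all `s` and `h` is differentiable at `(t, 0)` then `dh (t, 0) (τ, 0) = 0`.
[folklore] -/
theorem fderiv_apply_inl_eq_zero_of_apply_zero {F' G' : Type*} [NormedAddCommGroup F']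
    [NormedSpace ℝ F'] [NormedAddCommGroup G'] [NormedSpace ℝ G'] {h : ℝ × F' → G'} {c : G'}
    (h0 : ∀ s : ℝ, h (s, 0) = c) {t : ℝ} (hd : DifferentiableAt ℝ h (t, 0)) (τ : ℝ) :
    fderiv ℝ h (t, 0) (τ, 0) = 0 := by
  have h1 : HasFDerivAt (fun s : ℝ => h (s, 0))
      ((fderiv ℝ h (t, 0)).comp (ContinuousLinearMap.inl ℝ ℝ F')) t :=
    hd.hasFDerivAt.comp t (hasFDerivAt_prodMk_left t (0 : F'))
  have h2 : HasFDerivAt (fun s : ℝ => h (s, 0)) (0 : ℝ →L[ℝ] G') t := by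
    have : (fun s : ℝ => h (s, 0)) = fun _ => c := funext h0
    rw [this]
    exact hasFDerivAt_const c t
  have := h1.unique h2
  have key := DFunLike.congr_fun this τ
  simpa using key

/-- **The vertical derivative at the zero section**: if `u ↦ h (t, u)` has derivative `L` at
`0` and `h` is differentiable at `(t, 0)` then `dh (t, 0) (0, ξ) = L ξ`. [folklore] -/
theorem fderiv_apply_inr_eq {F' G' : Type*} [NormedAddCommGroup F'] [NormedSpace ℝ F']
    [NormedAddCommGroup G'] [NormedSpace ℝ G'] {h : ℝ × F' → G'} {t : ℝ} {L : F' →L[ℝ] G'}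
    (hL : HasFDerivAt (fun u : F' => h (t, u)) L 0) (hd : DifferentiableAt ℝ h (t, 0))
    (ξ : F') : fderiv ℝ h (t, 0) (0, ξ) = L ξ := by
  have h1 : HasFDerivAt (fun u : F' => h (t, u))
      ((fderiv ℝ h (t, 0)).comp (ContinuousLinearMap.inr ℝ ℝ F')) 0 :=
    hd.hasFDerivAt.comp (0 : F') (hasFDerivAt_prodMk_right t (0 : F'))
  have := h1.unique hL
  have key := DFunLike.congr_fun this ξ
  simpa using key

/-- **Polar read-off with a prescribed total angle and norm** (the form of
`eq_sqrt_mul_cos_and_eq_sqrt_mul_sin` used below): if moreover `t + θ = φ` for the offset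
angle `θ` and `w₀² + w₁² = R`, then `w = √R (cos 2πφ, sin 2πφ)`. [folklore] -/
theorem eq_sqrt_mul_cos_and_eq_sqrt_mul_sin_of_eq (w₀ w₁ t φ R : ℝ)
    (ha : 0 < w₀ * Real.cos (2 * Real.pi * t) + w₁ * Real.sin (2 * Real.pi * t))
    (hφ : t + Real.arctan ((-w₀ * Real.sin (2 * Real.pi * t) + w₁ * Real.cos (2 * Real.pi * t)) /
        (w₀ * Real.cos (2 * Real.pi * t) + w₁ * Real.sin (2 * Real.pi * t))) / (2 * Real.pi) = φ)
    (hR : w₀ ^ 2 + w₁ ^ 2 = R) :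
    w₀ = √R * Real.cos (2 * Real.pi * φ) ∧ w₁ = √R * Real.sin (2 * Real.pi * φ) := by
  subst hφ hR
  exact eq_sqrt_mul_cos_and_eq_sqrt_mul_sin w₀ w₁ t ha

/-! ### The normal form -/

/-- **The `S¹`-parametric fold normal form of the round circle, given a periodic adapted
frame.**  For a genus-one Lefschetz-free SBLF `f : X → S²` on a closed `4`-manifold with
equatorial round image and torus-side pole `v = (0, 0, v₂)`: IF the page Hessians of the height
`⟪v, f ∘ ν₀ (circlePt t, x)⟫` along some tube `ν₀` about the round circle admit a `C^∞`
`1`-periodic frame adapted to `2 (a₀b₀ + a₁b₁ - a₂b₂)` (the untwistedness of the round handle),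
THEN there are `0 < ε < 1` and `ν : S¹ × ℝ³ → X`, a `C^∞` embedding of `S¹ × B(0, ε)` onto an
open neighbourhood of the round locus (its zero section), in which
`f (ν (u, x)) = (√(1 - s²) u₀, √(1 - s²) u₁, v₂ s)`, `s = x₀² + x₁² - x₂²` (parametric Morse
lemma, Hirsch 1976 Ch. 6 §1, and the tube inverse function theorem; cf. Baykur–Kamada 2015,
§2: the round singular circle is a fibrewise fold). [cite: HirschDT1976, Ch. 6 §1, Thm. 1.1]
[cite: BanyagaHurtubise2004, Thm. 2] -/
theorem helper_foldNF_ofFrame : ∀ (X : Type) [TopologicalSpace X] [T2Space X] [SecondCountableTopology X] [CompactSpace X] [ChartedSpace (𝔼 4) X] [IsManifold (𝓡 4) ∞ X] (o : SmoothOrientation (𝓡 4) X) (f : X → 𝕊²), IsSimplifiedBrokenLefschetzFibration o f ∅ 0 → f '' ({p : X | ¬ Surjective (mfderiv (𝓡 4) (𝓡 2) f p)} \ (↑(∅ : Finset X) : Set X)) = sphereEquator 1 → ∀ (v : 𝕊²), (v : 𝔼 3) 0 = 0 → (v : 𝔼 3) 1 = 0 → (∀ y : 𝕊², ⟪(y :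 𝔼 3), (v : 𝔼 3)⟫ < 0 → (∀ q, f q = y → Surjective (mfderiv (𝓡 4) (𝓡 2) f q)) ∧ Nonempty ((Fin (2 * 0) → ℤ) ≃ₗ[ℤ] singularHomology ℤ ℤ ↥(f ⁻¹' {y}) 1)) → (∀ y : 𝕊², ⟪(y : 𝔼 3), ((-v : 𝕊²) : 𝔼 3)⟫ < 0 → (∀ q, f q = y → Surjective (mfderiv (𝓡 4) (𝓡 2) f q)) ∧ Nonempty ((Fin (2 * (0 + 1)) → ℤ) ≃ₗ[ℤ] singularHomology ℤ ℤ ↥(f ⁻¹' {y}) 1)) → (∃ (e : Metric.sphere (0 : 𝔼 2) 1 → X) (ν₀ : CircleNbhd (𝓡 4) e) (M Minv : ℝ → (𝔼 3 →L[ℝ] 𝔼 3)), Set.range e = {p : X | ¬ Surjective (mfderiv (𝓡 4) (𝓡 2) f p)} \ (↑(∅ : Finset X) : Set X) ∧ (∀ u, f (e u) = sphereInclusion 1 2 one_le_two u) ∧ ContDiff ℝ ∞ M ∧ ContDiff ℝ ∞ Minv ∧ (∀ t : ℝ, M (t + 1) = M t) ∧ (∀ t : ℝ, Minv (t + 1)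 = Minv t) ∧ (∀ (t : ℝ) (a : 𝔼 3), M t (Minv t a) = a) ∧ (∀ (t : ℝ) (a : 𝔼 3), Minv t (M t a) = a) ∧ (∀ (t : ℝ) (a b : 𝔼 3), fderiv ℝ (fderiv ℝ (fun q : ℝ × 𝔼 3 => SphereHeight.height (v : 𝔼 3) (f (ν₀.toFun (circlePt q.1, q.2))))) (t, 0) ((0 : ℝ), a) ((0 : ℝ), b) = 2 * ((M t a) 0 * (M t b) 0 + (M t a) 1 * (M t b) 1 - (M t a) 2 * (M t b) 2))) → ∃ (ε : ℝ) (ν : (Metric.sphere (0 : 𝔼 2) 1) × 𝔼 3 → X), 0 < ε ∧ ε < 1 ∧ ContMDiffOn ((𝓡 1).prod 𝓘(ℝ, 𝔼 3)) (𝓡 4) ∞ ν (Set.univ ×ˢ Metric.ball 0 ε) ∧ Set.InjOn ν (Set.univ ×ˢ Metric.ball 0 ε) ∧ IsOpen (ν '' (Set.univ ×ˢ Metric.ball 0 ε)) ∧ (∀ p : (Metric.sphere (0 : 𝔼 2) 1) × 𝔼 3, p.2 ∈ Metric.ball (0 : 𝔼 3) ε → Function.Injective (mfderiv ((𝓡 1).prod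 𝓘(ℝ, 𝔼 3)) (𝓡 4) ν p)) ∧ (∀ q : X, ¬ Surjective (mfderiv (𝓡 4) (𝓡 2) f q) ↔ ∃ u, ν (u, 0) = q) ∧ (∀ (u : Metric.sphere (0 : 𝔼 2) 1) (x : 𝔼 3), x ∈ Metric.ball (0 : 𝔼 3) ε → ((f (ν (u, x)) : 𝕊²) : 𝔼 3) 0 = √(1 - (x 0 ^ 2 + x 1 ^ 2 - x 2 ^ 2) ^ 2) * (u : 𝔼 2) 0 ∧ ((f (ν (u, x)) : 𝕊²) : 𝔼 3) 1 = √(1 - (x 0 ^ 2 + x 1 ^ 2 - x 2 ^ 2) ^ 2) * (u : 𝔼 2) 1 ∧ ((f (ν (u, x)) : 𝕊²) : 𝔼 3) 2 = (v : 𝔼 3) 2 * (x 0 ^ 2 + x 1 ^ 2 - x 2 ^ 2)) := by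
  intro X _ _ _ _ _ _ o f hf hround v hv0 hv1 hlo hhi hframe
  obtain ⟨e, ν₀, M, Minv, hrange, hfe, hM, hMinv, hMT, hMinvT, hMM, hMM', hadapt⟩ := hframe
  obtain ⟨hFs, hF0, hF1, hgs, hg0, hdg, hgF⟩ :=
    helper_foldNF_family X o f hf hround v hv0 hv1 e ν₀ hrange hfe
  set F : ℝ × 𝔼 3 → 𝔼 3 := fun q => ((f (ν₀.toFun (circlePt q.1, q.2)) : 𝕊²) : 𝔼 3) with hFdef
  set g : ℝ × 𝔼 3 → ℝ := fun q => SphereHeight.height (v : 𝔼 3) (f (ν₀.toFun (circlePt q.1, q.2)))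
    with hgdef
  have hSo : ∀ ρ : ℝ, IsOpen ((univ : Set ℝ) ×ˢ ball (0 : 𝔼 3) ρ) := fun ρ =>
    isOpen_univ.prod isOpen_ball
  have hv2 : (v : 𝔼 3) 2 * (v : 𝔼 3) 2 = 1 := by
    have h := norm_eq_of_mem_sphere v
    have h1 : ‖(v : 𝔼 3)‖ ^ 2 = 1 := by rw [h, one_pow]
    rw [← real_inner_self_eq_norm_sq, BandFoliation.inner_eq_three, hv0, hv1] at h1
    linarith
  -- periodicity
  have hFT : ∀ (t : ℝ) (x : 𝔼 3), F (t + 1, x) = F (t, x) := fun t x => by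
    simp [hFdef, circlePt_add_one]
  have hgT : ∀ (t : ℝ) (x : 𝔼 3), g (t + 1, x) = g (t, x) := fun t x => by
    simp [hgdef, circlePt_add_one]
  ---------------------------------------------------------------- Morse coordinates
  obtain ⟨B, hB⟩ := exists_clm_sliceForm
  have hBsymm : ∀ a b, B a b = B b a := fun a b => by rw [hB, hB]; ring
  have hBnd : ∀ a, (∀ b, B a b = 0) → a = 0 := by
    intro a h
    have h0 := h (EuclideanSpace.single 0 1)
    have h1 := h (EuclideanSpace.single 1 1)
    have h2 := h (EuclideanSpace.single 2 1)
    simp [hB] at h0 h1 h2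
    ext i
    fin_cases i
    · simpa using h0
    · simpa using h1
    · simpa using h2
  have hσ : sigNeg ((B.toBilinForm).toQuadraticMap) = 1 := by
    have := sigNeg_of_forall_apply_eq_sliceForm B.toBilinForm (β := 1 / 2) (by norm_num)
      (fun a b => by rw [ContinuousLinearMap.toBilinForm_apply, hB]; ring)
    rw [this, if_pos (by norm_num)]
  have h1 : ∀ (t : ℝ) (a : 𝔼 3), fderiv ℝ g (t, 0) ((0 : ℝ), a) = 0 := fun t a => by
    rw [hdg t]; rfl
  have hadapt' : ∀ (t : ℝ) (a b : 𝔼 3),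
      fderiv ℝ (fderiv ℝ g) (t, 0) ((0 : ℝ), a) ((0 : ℝ), b) = 2 * B (M t a) (M t b) :=
    fun t a b => by rw [hB]; exact hadapt t a b
  obtain ⟨r, y, Λ, hr, hys, hyT, hy0, hyd, -, hgy⟩ :=
    Splitting.exists_periodic_fibrewiseMorseCoords_of_frame (n := 3) hgs one_pos hgT hg0 h1 B
      hBsymm hBnd (by simp) hM hMinv hMT hMinvT hMM hMM' hadapt'
  have hgy' : ∀ (t : ℝ) (u : 𝔼 3), u ∈ ball (0 : 𝔼 3) r →
      g (t, u) = -(y (t, u) 0) ^ 2 + ((y (t, u) 1) ^ 2 + (y (t, u) 2) ^ 2) := fun t u hu => by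
    rw [hgy t u hu, hσ]
    exact sum_sq_filter_one _
  ---------------------------------------------------------------- the longitude offset
  set A : ℝ × 𝔼 3 → ℝ := fun q =>
    F q 0 * Real.cos (2 * Real.pi * q.1) + F q 1 * Real.sin (2 * Real.pi * q.1) with hAdef
  set Bq : ℝ × 𝔼 3 → ℝ := fun q =>
    -F q 0 * Real.sin (2 * Real.pi * q.1) + F q 1 * Real.cos (2 * Real.pi * q.1) with hBqdef
  set θ : ℝ × 𝔼 3 → ℝ := fun q => Real.arctan (Bq q / A q) / (2 * Real.pi) with hθdef
  have hcos : ContDiff ℝ ∞ fun q : ℝ × 𝔼 3 => Real.cos (2 * Real.pi * q.1) :=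
    Real.contDiff_cos.comp (contDiff_const.mul contDiff_fst)
  have hsin : ContDiff ℝ ∞ fun q : ℝ × 𝔼 3 => Real.sin (2 * Real.pi * q.1) :=
    Real.contDiff_sin.comp (contDiff_const.mul contDiff_fst)
  have hFi : ∀ i : Fin 3, ContDiff ℝ ∞ fun q : ℝ × 𝔼 3 => F q i := fun i =>
    (contDiff_euclidean.1 hFs) i
  have hAs : ContDiff ℝ ∞ A := ((hFi 0).mul hcos).add ((hFi 1).mul hsin)
  have hBqs : ContDiff ℝ ∞ Bq := ((hFi 0).neg.mul hsin).add ((hFi 1).mul hcos)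
  have hθs : ∀ q, A q ≠ 0 → ContDiffAt ℝ ∞ θ q := fun q hq =>
    ((hBqs.contDiffAt.div hAs.contDiffAt hq).arctan).div_const _
  have hA0 : ∀ t : ℝ, A (t, 0) = 1 := fun t => by
    obtain ⟨e0, e1, -⟩ := hF0 t
    simp only [hAdef, hFdef] at e0 e1 ⊢
    rw [e0, e1]
    nlinarith [Real.cos_sq_add_sin_sq (2 * Real.pi * t)]
  have hBq0 : ∀ t : ℝ, Bq (t, 0) = 0 := fun t => by
    obtain ⟨e0, e1, -⟩ := hF0 t
    simp only [hBqdef, hFdef] at e0 e1 ⊢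
    rw [e0, e1]
    ring
  have hθ0 : ∀ t : ℝ, θ (t, 0) = 0 := fun t => by
    simp only [hθdef, hBq0, zero_div, Real.arctan_zero]
  have hper2π : ∀ t : ℝ, 2 * Real.pi * (t + 1) = 2 * Real.pi * t + 2 * Real.pi := fun t => by ring
  have hAT : ∀ (t : ℝ) (x : 𝔼 3), A (t + 1, x) = A (t, x) := fun t x => by
    simp only [hAdef, hFT, hper2π, Real.cos_add_two_pi, Real.sin_add_two_pi]
  have hBqT : ∀ (t : ℝ) (x : 𝔼 3), Bq (t + 1, x) = Bq (t, x) := fun t x => by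
    simp only [hBqdef, hFT, hper2π, Real.cos_add_two_pi, Real.sin_add_two_pi]
  have hθT : ∀ (t : ℝ) (x : 𝔼 3), θ (t + 1, x) = θ (t, x) := fun t x => by
    simp only [hθdef, hAT, hBqT]
  -- a uniform tube on which `A > 1/2`
  obtain ⟨r₀, hr₀, hAr₀⟩ : ∃ r₀ > 0, ∀ (t : ℝ) (x : 𝔼 3), x ∈ ball (0 : 𝔼 3) r₀ → 1 / 2 < A (t, x) := by
    have hWo : IsOpen (A ⁻¹' Ioi (1 / 2 : ℝ)) := isOpen_Ioi.preimage hAs.continuous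
    obtain ⟨r₀, hr₀, h⟩ := exists_ball_subset_of_forall_add (F := 𝔼 3) hWo
      (fun t => by simp [hA0 t]; norm_num) one_pos (fun t u h => by simpa [hAT] using h)
      (fun t u h => by
        have := hAT (t - 1) u
        rw [sub_add_cancel] at this
        simpa [← this] using h)
    exact ⟨r₀, hr₀, fun t x hx => h t x hx⟩
  ---------------------------------------------------------------- the map `Ψ`
  set Ψ : ℝ × 𝔼 3 → ℝ × 𝔼 3 := fun q => (q.1 + θ q, cycle3 (y q)) with hΨdef
  set r₁ : ℝ := min r r₀ with hr₁def
  have hr₁ : 0 < r₁ := lt_min hr hr₀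
  have hmem_r : ∀ {t : ℝ} {x : 𝔼 3}, x ∈ ball (0 : 𝔼 3) r₁ → x ∈ ball (0 : 𝔼 3) r := fun hx =>
    ball_subset_ball (min_le_left _ _) hx
  have hmem_r₀ : ∀ {t : ℝ} {x : 𝔼 3}, x ∈ ball (0 : 𝔼 3) r₁ → x ∈ ball (0 : 𝔼 3) r₀ := fun hx =>
    ball_subset_ball (min_le_right _ _) hx
  have hΨs : ContDiffOn ℝ ∞ Ψ ((univ : Set ℝ) ×ˢ ball (0 : 𝔼 3) r₁) := by
    rintro ⟨t, x⟩ ⟨-, hx⟩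
    have hA : A (t, x) ≠ 0 := by have := hAr₀ t x (hmem_r₀ (t := t) hx); intro h; rw [h] at this; norm_num at this
    have hyat : ContDiffAt ℝ ∞ y (t, x) := hys.contDiffAt ((hSo r).mem_nhds ⟨mem_univ _, hmem_r (t := t) hx⟩)
    exact ((contDiffAt_fst.add (hθs _ hA)).prodMk (cycle3.contDiff.contDiffAt.comp _ hyat)).contDiffWithinAt
  have hΨ0 : ∀ t : ℝ, Ψ (t, 0) = (t, 0) := fun t => by
    simp only [hΨdef, hθ0, hy0, add_zero, map_zero]
  have hΨT : ∀ (t : ℝ) (x : 𝔼 3), Ψ (t + 1, x) = Ψ (t, x) + (1, 0) := fun t x => by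
    simp only [hΨdef, hθT, hyT, Prod.mk_add_mk, add_zero]
    ring_nf
  have hΨinv : ∀ t : ℝ, (fderiv ℝ Ψ (t, 0)).IsInvertible := by
    intro t
    have hA : A (t, 0) ≠ 0 := by rw [hA0]; norm_num
    have hθd : DifferentiableAt ℝ θ (t, 0) := (hθs _ hA).differentiableAt (by simp)
    have hyat : ContDiffAt ℝ ∞ y (t, 0) := hys.contDiffAt ((hSo r).mem_nhds ⟨mem_univ _, mem_ball_self hr⟩)
    have hyd' : DifferentiableAt ℝ y (t, 0) := hyat.differentiableAt (by simp)
    have hΨd : HasFDerivAt Ψ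
        ((ContinuousLinearMap.fst ℝ ℝ (𝔼 3) + fderiv ℝ θ (t, 0)).prod
          (cycle3.comp (fderiv ℝ y (t, 0)))) (t, 0) :=
      (hasFDerivAt_fst.add hθd.hasFDerivAt).prodMk (cycle3.hasFDerivAt.comp _ hyd'.hasFDerivAt)
    rw [hΨd.fderiv]
    set L := (ContinuousLinearMap.fst ℝ ℝ (𝔼 3) + fderiv ℝ θ (t, 0)).prod
      (cycle3.comp (fderiv ℝ y (t, 0))) with hL
    -- the kernel is trivial
    have hθh : ∀ τ : ℝ, fderiv ℝ θ (t, 0) (τ, 0) = 0 := fderiv_apply_inl_eq_zero_of_apply_zero hθ0 hθd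
    have hyh : ∀ τ : ℝ, fderiv ℝ y (t, 0) (τ, 0) = 0 := fderiv_apply_inl_eq_zero_of_apply_zero hy0 hyd'
    have hyv : ∀ ξ : 𝔼 3, fderiv ℝ y (t, 0) (0, ξ) = Λ (M t ξ) := fun ξ => by
      rw [fderiv_apply_inr_eq (hyd t) hyd' ξ]; rfl
    have hinj : Injective L := by
      rintro ⟨τ, ξ⟩ ⟨τ', ξ'⟩ hq
      rw [← sub_eq_zero] at hq ⊢
      rw [← map_sub] at hq
      set d := ((τ, ξ) : ℝ × 𝔼 3) - (τ', ξ') with hd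
      obtain ⟨d1, d2⟩ := d
      have hsplit : ((d1, d2) : ℝ × 𝔼 3) = (d1, 0) + (0, d2) := by simp
      have e2 : cycle3 (fderiv ℝ y (t, 0) (d1, d2)) = 0 := congrArg Prod.snd hq
      rw [hsplit, map_add, hyh, hyv, zero_add] at e2
      have e3 : M t d2 = 0 := by
        have := cycle3_injective (e2.trans (map_zero _).symm)
        exact Λ.injective (this.trans (map_zero _).symm)
      have hd2 : d2 = 0 := by rw [← hMM' t d2, e3, map_zero]
      have e1 : d1 + fderiv ℝ θ (t, 0) (d1, d2) = 0 := congrArg Prod.fst hq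
      rw [hd2, hθh, add_zero] at e1
      rw [e1, hd2]
      rfl
    exact ⟨(LinearEquiv.ofInjectiveEndo L.toLinearMap hinj).toContinuousLinearEquiv,
      ContinuousLinearMap.ext fun q => rfl⟩
  ---------------------------------------------------------------- invert and descend
  obtain ⟨ε, Φ, hε, hΦs, hΦ0, hΦT, hΦinv, -, hΦopen⟩ :=
    helper_foldNF_tubeIFT (𝔼 3) Ψ r₁ 1 hr₁ one_pos hΨs hΨ0 hΨT hΨinv
  set ε' : ℝ := min ε (1 / 2) with hε'def
  have hε' : 0 < ε' := lt_min hε (by norm_num)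
  have hε'1 : ε' < 1 := (min_le_right _ _).trans_lt (by norm_num)
  have hεε : ∀ {x : 𝔼 3}, x ∈ ball (0 : 𝔼 3) ε' → x ∈ ball (0 : 𝔼 3) ε := fun hx =>
    ball_subset_ball (min_le_left _ _) hx
  have hΦs' : ContDiffOn ℝ ∞ Φ ((univ : Set ℝ) ×ˢ ball (0 : 𝔼 3) ε') :=
    hΦs.mono (prod_mono le_rfl (ball_subset_ball (min_le_left _ _)))
  have hΦT' : ∀ (s : ℝ) (x : 𝔼 3), x ∈ ball (0 : 𝔼 3) ε' → Φ (s + 1, x) = Φ (s, x) + (1, 0) :=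
    fun s x hx => hΦT s x (hεε hx)
  have hΦinv' : ∀ q ∈ (univ : Set ℝ) ×ˢ ball (0 : 𝔼 3) ε',
      Φ q ∈ (univ : Set ℝ) ×ˢ ball (0 : 𝔼 3) r₁ ∧ Ψ (Φ q) = q := fun q hq =>
    hΦinv q ⟨mem_univ _, hεε hq.2⟩
  have hΦopen' : IsOpen (Φ '' ((univ : Set ℝ) ×ˢ ball (0 : 𝔼 3) ε')) := by
    have heq : Φ '' ((univ : Set ℝ) ×ˢ ball (0 : 𝔼 3) ε') =
        Φ '' ((univ : Set ℝ) ×ˢ ball (0 : 𝔼 3) ε) ∩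
          (((univ : Set ℝ) ×ˢ ball (0 : 𝔼 3) r₁) ∩ Ψ ⁻¹' ((univ : Set ℝ) ×ˢ ball (0 : 𝔼 3) ε')) := by
      refine subset_antisymm ?_ ?_
      · rintro _ ⟨q, hq, rfl⟩
        obtain ⟨h1, h2⟩ := hΦinv' q hq
        exact ⟨⟨q, ⟨mem_univ _, hεε hq.2⟩, rfl⟩, h1, by rw [mem_preimage, h2]; exact hq⟩
      · rintro p ⟨⟨q, hq, rfl⟩, -, hp⟩
        rw [mem_preimage, (hΦinv q hq).2] at hp
        exact ⟨q, hp, rfl⟩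
    rw [heq]
    exact hΦopen.inter (hΨs.continuousOn.isOpen_inter_preimage (hSo r₁) (hSo ε'))
  obtain ⟨ν, hνf, hνs, hνinj, hνopen, hνd⟩ := helper_foldNF_descend X e ν₀ Ψ Φ r₁ ε' hr₁ hε' hΨs hΦs'
    hΨT hΦT' hΦinv' hΦopen'
  have hsurj : ∀ u : Metric.sphere (0 : 𝔼 2) 1, ∃ s : ℝ, circlePt s = u := fun u =>
    ⟨angA u, circlePt_angA u⟩
  have hν0 : ∀ s : ℝ, ν (circlePt s, 0) = e (circlePt s) := fun s => by
    rw [hνf s 0 (mem_ball_self hε'), hΦ0 s]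
    exact ν₀.apply_zero _
  refine ⟨ε', ν, hε', hε'1, hνs, hνinj, hνopen, hνd, fun q => ⟨fun hq => ?_, ?_⟩, fun u x hx => ?_⟩
  · -- round points are on the zero section
    have hq' : q ∈ range e := by rw [hrange]; exact ⟨hq, by simp⟩
    obtain ⟨u, rfl⟩ := hq'
    obtain ⟨s, rfl⟩ := hsurj u
    exact ⟨circlePt s, hν0 s⟩
  · rintro ⟨u, rfl⟩
    obtain ⟨s, rfl⟩ := hsurj u
    rw [hν0 s]
    have : e (circlePt s) ∈ {p : X | ¬ Surjective (mfderiv (𝓡 4) (𝓡 2) f p)} \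
        (↑(∅ : Finset X) : Set X) := hrange ▸ mem_range_self _
    exact this.1
  · ---------------------------------------------------------------- the model
    obtain ⟨s, rfl⟩ := hsurj u
    rw [hνf s x hx]
    obtain ⟨hmem, hΨΦ⟩ := hΦinv' (s, x) ⟨mem_univ _, hx⟩
    set t' : ℝ := (Φ (s, x)).1 with ht'
    set x' : 𝔼 3 := (Φ (s, x)).2 with hx'
    have hx'r₁ : x' ∈ ball (0 : 𝔼 3) r₁ := hmem.2
    have hΨ' : Ψ (t', x') = (s, x) := by rw [ht', hx', Prod.mk.eta]; exact hΨΦ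
    have hts : t' + θ (t', x') = s := congrArg Prod.fst hΨ'
    have hyx : cycle3 (y (t', x')) = x := congrArg Prod.snd hΨ'
    rw [cycle3_apply] at hyx
    have hy0' : y (t', x') 1 = x 0 := by rw [← hyx]; rfl
    have hy1' : y (t', x') 2 = x 1 := by rw [← hyx]; rfl
    have hy2' : y (t', x') 0 = x 2 := by rw [← hyx]; rfl
    -- the height is `Q x`
    have hgx : g (t', x') = x 0 ^ 2 + x 1 ^ 2 - x 2 ^ 2 := by
      rw [hgy' t' x' (hmem_r (t := t') hx'r₁), hy0', hy1', hy2']; ring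
    have hF2 : F (t', x') 2 = (v : 𝔼 3) 2 * (x 0 ^ 2 + x 1 ^ 2 - x 2 ^ 2) := by
      have e1 : g (t', x') = (v : 𝔼 3) 2 * F (t', x') 2 := hgF (t', x')
      rw [hgx] at e1
      have := congrArg (fun z => (v : 𝔼 3) 2 * z) e1
      simp only at this
      rw [← mul_assoc, hv2, one_mul] at this
      exact this.symm
    have hF2sq : F (t', x') 2 ^ 2 = (x 0 ^ 2 + x 1 ^ 2 - x 2 ^ 2) ^ 2 := by
      rw [hF2, mul_pow, pow_two ((v : 𝔼 3) 2), hv2, one_mul]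
    -- the first two coordinates from the longitude
    have hhalf : (0 : ℝ) < 1 / 2 := by norm_num
    have hApos : 0 < A (t', x') := hhalf.trans (hAr₀ t' x' (hmem_r₀ (t := t') hx'r₁))
    have hnorm : F (t', x') 0 ^ 2 + F (t', x') 1 ^ 2 = 1 - (x 0 ^ 2 + x 1 ^ 2 - x 2 ^ 2) ^ 2 := by
      rw [← hF2sq]; linarith [hF1 (t', x')]
    obtain ⟨e0, e1⟩ := eq_sqrt_mul_cos_and_eq_sqrt_mul_sin_of_eq (F (t', x') 0) (F (t', x') 1) t' s
      _ hApos hts hnorm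
    have hc0 : ((circlePt s : Metric.sphere (0 : 𝔼 2) 1) : 𝔼 2) 0 = Real.cos (2 * Real.pi * s) := rfl
    have hc1 : ((circlePt s : Metric.sphere (0 : 𝔼 2) 1) : 𝔼 2) 1 = Real.sin (2 * Real.pi * s) := rfl
    rw [hc0, hc1]
    exact ⟨e0, e1, hF2⟩

end Summit.SmoothPoincare4.SmoothPoincare4.Cruxes.RungOne.Sketch

end
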